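import Literature.NumberTheory.QuadraticFields.QuadraticDedekindZeta
import Literature.NumberTheory.QuadraticFields.ImaginaryResiduePiForm
import Literature.NumberTheory.LFunctions.RealZeroEffectiveRepulsionExplicitII
import Literature.NumberTheory.LFunctions.HeckeLOneLowerBoundExplicit
import Literature.NumberTheory.QuadraticFields.JacobiCharacterPrimitiveProofs
import Literature.Barriers.Parity.SiegelZeroDichotomy
import HarnessLib

/-!
# Small split primes in the exceptional imaginary quadratic field: a mild Siegel zero forces
# `N_q(P) ≫ h(−q)P/(√q log²q)` split primes `p ≤ P`, `q^{1/2+ε} ≤ P ≤ q`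
# (Dunn–Kerr–Shparlinski–Zaharescu 2020, Theorem 5)

Statement layer for the cell `parity-realchar` (SIEGEL INSTRUMENT, deliverable (3): the «illusory
world» typed), NEW-TOPIC CANDIDATE «small split primes / quadratic residues below the conductor under
an exceptional character» (theory's topic-vs-source call pending). Source: A. Dunn, B. Kerr,
I. E. Shparlinski, A. Zaharescu, *Bilinear forms in Weyl sums for modular square roots and
applications*, Adv. Math. 375 (2020) 107369 [DunnKerrShparlinskiZaharescu2020]; held copy =
arXiv:1908.10143 (tex), §1.1 (the objects `χ = (−q/·)`, `F = ℚ(√−q)`, `N_q(P)`), §1.2 Theorems 1, 5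
and Remarks 2, 6, §5 (proof of Theorem 5: β-sieve on the `h(−q)` reduced forms in Duke's box, then
"we sift `𝓕_{−q}` down to just primes using the Siegel zero").

## What the source prints (§1.1–§1.2)

§1.1: "if `q ≡ 3 (mod 4)` is a large prime, then quadratic reciprocity tells us that … `(−q/p) = (p/q)`.
Thus counting quadratic residues modulo `q` is equivalent to counting small rational primes `p ≤ P`
that split in the imaginary quadratic field `F := ℚ(√−q)`. … `χ(·) := (−q/·)` … always denotes the
character attached to `F` … Let `N_q(P)` denote the number of rational primes `p ≤ P` that split in
`F`." Context: under GRH `N_q(P) ≥ c₁P/log P` for `P ≥ c₂(log q)²` [MoVa]. "Many famous unsolved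
conjectures are known to hold under the assumption of a Siegel zero [FI]. This is because one can
sometimes break the parity problem of the sieve with this hypothesis. A notable example is
Heath-Brown's proof [HB2] of the twin prime conjecture assuming Siegel zeros. Continuing this
tradition, we prove an essentially sharp lower bound for `N_q(P)` under the assumption that `L(s,χ)`
has a mild Siegel zero."
**Theorem 5.** "Suppose `q ≡ 3 (mod 4)` is a large prime and (1.5) `L(1, χ) = O(1/(log q)^{10})`. Then
for any fixed `ε > 0` and `P` with `q^{1/2+ε} ≤ P ≤ q`, we have `N_q(P) ≥ c(ε) h(−q) P/(√q (log q)²)`,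
where `h(−q)` is the class number of `F = ℚ(√−q)` and `c(ε) > 0` depends only on `ε`."
**Remark 6.** "The constant `c(ε)` in Theorem 5 is ineffective." (Duke's equidistribution of Heegner
points and Siegel's theorem enter the proof, §5.2–5.3.)

## Typing notes

* `F = ℚ(√−q)` is ANY number field `K` with `[K : ℚ] = 2` and `d_K = −q` (for a prime `q` this forces
  `q ≡ 3 (mod 4)`, kept as a printed hypothesis); `h(−q) = classNumber K`; "`p` splits in `F`" is
  `#(primes of 𝓞_K above p) = 2` (the tree's decomposition law
  `Quadratic.ncard_primesOver_eq_two_iff_jacobiSym` identifies it with `(d_K/p) = 1` for odd `p`);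
  `χ = (−q/·)` is the tree's `jacobiChar |d_K|` (`= (·/q) = (−q/·)` by reciprocity for `q ≡ 3 (4)`,
  `JacobiCharacter.lean`), whose `L(1, χ)` is the real number `2π h_K/(w_K √q)` by the tree's class
  number formula (`Quadratic.LFunction_jacobiChar_one_eq_of_discr_neg`).
* **Quantifiers.** "`q` large" and "`L(1,χ) = O((log q)^{−10})`" (an implicit `O`-constant `C`), "`c(ε)`
  depends only on `ε`": rendered `∀ ε > 0, ∀ C, ∃ c > 0, ∃ q₀, ∀ q ≥ q₀ …` — `c` is ALLOWED to depend
  on the `O`-constant `C` as well (WEAKER than print, safe direction; in the proof, §5.3, `C` only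
  enters the size of "`q` large enough").
* **S6 vacuity audit.** The hypothesis `L(1,χ_{−q}) ≤ C(log q)^{−10}` is an `L(1)`-side strength-10
  hypothesis at ONE prime conductor (cf. the tree's `ExceptionalCharactersOfStrength 10`); by the
  class number formula it says `h(−q) ≤ (C/π)√q (log q)^{−10}`. Siegel's (ineffective) theorem
  `L(1,χ) ≫_δ q^{−δ}` does NOT void it (a power of `log` is allowed by every `q^{−δ}`), and the
  effective kernel floor `√q·L(1,χ) ≥ 2π/9` (odd `χ`) only forces `(log q)^{10} ≤ (9C/(2π))√q…`, i.e.
  `q` beyond an explicit but small threshold. Not S6. `DKSZ2020.lOne_hypothesis_of_isSiegelZero`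
  (PROVED) records when the column's ZERO-side predicate triggers it: a Siegel zero of quality
  `η ≥ (log q)^{11}` (at `q ≥ 232`) gives `L(1,χ) ≤ log q/η ≤ (log q)^{−10}` by the kernel's explicit
  Montgomery–Vaughan (11.10).

## Contents

* definition `DKSZ2020.splitPrimeCount K P` (`N_q(P)`);
* `dksz2020_theorem5` — NAMED FACT, Theorem 5 AS PRINTED (with Remark 6 recorded);
* PROVED: `DKSZ2020.lOne_hypothesis_of_isSiegelZero` (zero-side trigger),
  `DKSZ2020.splitPrimeCount_ge_of_isSiegelZero` (Theorem 5 read on `IsSiegelZero` of quality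
  `≥ (log q)^{11}`), `DKSZ2020.splitPrimeCount_ge_lOne` (the conclusion in `L(1)`-currency through the
  class number formula and `w_K = 2`: `N_q(P) ≥ (c/π)·L(1,χ)·P/(log q)²`); appended 2026-08-27 (S4/S6
  links, kernel): `DKSZ2020.not_lOne_hypothesis_of_small` (CNF floor `0.69/√q` ⇒ (1.5) void when
  `C√q < 0.69 (log q)^{10}`, e.g. `C = 1`, `q ≤ e^{89}`), `not_lOne_hypothesis_of_noRealZeroUpTo` (+
  `_upTo_1e10_of_leaf`: on the certified range `10⁴ ≤ q ≤ Q` the kernel Hecke bound `1/(8 log q)` voids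
  (1.5) for `8C < (log q)^9`).

Index only (not typed): Theorem 1 (unconditional, ineffective: `N_q(P) ≥ c(ε) min{P^{1/2}q^{−ε/2},
Pq^{−1/4−2ε/3}}` for `q^{1/4+ε} ≤ P ≤ q`), Theorem 3 (effective `N_q(q) ≥ 0.1 log q/log log q`-type
bound via the resultant `𝐑_q`), §1.3 Theorems 7–8 (bilinear forms with modular square roots), the
GRH benchmark [MoVa].

LABEL: instrument / statement layer («illusory world»). WHAT THIS IS NOT: no claim that an
exceptional character exists; the constant is ineffective (Remark 6); nothing here bears on parity.

## References

* [DunnKerrShparlinskiZaharescu2020] A. Dunn, B. Kerr, I. E. Shparlinski, A. Zaharescu, Adv. Math.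
  375 (2020) 107369, doi:10.1016/j.aim.2020.107369 = arXiv:1908.10143: §1.1, §1.2 Theorem 5 and
  Remark 6, §5.
* [NeukirchANT1999] Ch. VII §5 (5.11) (class number formula, as proved in the tree).
* [MontgomeryVaughan2007] Theorem 11.4 (11.10) (as proved in the tree with constant `1`:
  `RealZeroRepulsion.isSiegelZero_eta_le_log_sq_div`).
* [TaoTeravainen2021] Definition 1.4 (`IsSiegelZero`).
-/

noncomputable section

open Finset Real
open Literature.Barriers.Parity
open Literature.NumberTheory.QuadraticFields Literature.NumberTheory.QuadraticFields.Quadratic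
open _root_.NumberField _root_.NumberField.Units Module Ideal

namespace Literature.NumberTheory.LFunctions

namespace DKSZ2020

variable (K : Type*) [Field K] [NumberField K]

/-- `N_q(P)` = "the number of rational primes `p ≤ P` that split in `F = ℚ(√−q)`" (two primes of
`𝓞_F` above `p`), for `F = K`. [cite: DunnKerrShparlinskiZaharescu2020, §1.1 (definition of N_q(P))] -/
def splitPrimeCount (P : ℝ) : ℕ :=
  ((Finset.Iic ⌊P⌋₊).filter
    (fun p : ℕ => p.Prime ∧ ((Ideal.span {(p : ℤ)}).primesOver (𝓞 K)).ncard = 2)).card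

end DKSZ2020

open DKSZ2020

/-- **Dunn–Kerr–Shparlinski–Zaharescu 2020, Theorem 5** (NAMED FACT, AS PRINTED; "`q` large" and the
implicit constant of `L(1,χ) = O((log q)^{−10})` rendered as `∀ C, ∃ q₀`, the constant `c(ε)` allowed
to depend on `C` as well — weaker than print; `F = ℚ(√−q)` = any `K` with `[K:ℚ] = 2`, `d_K = −q`;
`χ = (−q/·) = jacobiChar |d_K|`): for every `ε > 0` [and `C`] there are `c > 0` and `q₀` such that for
every prime `q ≥ q₀`, `q ≡ 3 (mod 4)`, with `L(1, χ) ≤ C/(log q)^{10}`, and every `P` with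
`q^{1/2+ε} ≤ P ≤ q`: `N_q(P) ≥ c·h(−q)·P/(√q (log q)²)`. Remark 6: `c` is ineffective. Not proved here
(β-sieve in the reduced forms of Duke's box, Siegel's theorem, the asymptotics for `∑ R_{−q}(m)`;
§5 of the source). [cite: DunnKerrShparlinskiZaharescu2020, §1.2 Theorem 5 and Remark 6] -/
def dksz2020_theorem5 : Prop :=
  ∀ ε : ℝ, 0 < ε → ∀ C : ℝ, ∃ c : ℝ, 0 < c ∧ ∃ q₀ : ℕ,
    ∀ (K : Type) [Field K] [NumberField K], finrank ℚ K = 2 →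
      ∀ q : ℕ, q.Prime → q % 4 = 3 → q₀ ≤ q → NumberField.discr K = -(q : ℤ) →
        ‖(jacobiChar (NumberField.discr K).natAbs).LFunction 1‖ ≤ C / Real.log q ^ 10 →
          ∀ P : ℝ, (q : ℝ) ^ (1 / 2 + ε) ≤ P → P ≤ q →
            c * (classNumber K : ℝ) * P / (Real.sqrt q * Real.log q ^ 2) ≤ (splitPrimeCount K P : ℝ)

namespace DKSZ2020

variable {K : Type*} [Field K] [NumberField K]

/-- `|d_K| = q` when `d_K = −q`. [folklore] -/
private theorem natAbs_discr_eq {q : ℕ} (hd : NumberField.discr K = -(q : ℤ)) :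
    (NumberField.discr K).natAbs = q := by
  rw [hd, Int.natAbs_neg, Int.natAbs_natCast]

/-- **Zero side ⇒ the hypothesis (1.5) of Theorem 5.** If `χ = jacobiChar |d_K|` (`d_K = −q`,
`q ≥ 232`) carries a Tao–Teräväinen Siegel zero of quality `η ≥ max(40, (log q)^{11})`, then
`L(1, χ) ≤ 1/(log q)^{10}` — by the kernel's explicit (11.10) `‖L(1,χ)‖ log q ≤ (log q)²/η`.
[cite: MontgomeryVaughan2007, Theorem 11.4 (11.10)] [cite: TaoTeravainen2021, Definition 1.4] -/
theorem lOne_hypothesis_of_isSiegelZero {q : ℕ} (hd : NumberField.discr K = -(q : ℤ))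
    (hq : 232 ≤ q) {η : ℝ} (hS : IsSiegelZero (jacobiChar (NumberField.discr K).natAbs) η)
    (h40 : 40 ≤ η) (hη : Real.log q ^ 11 ≤ η) :
    ‖(jacobiChar (NumberField.discr K).natAbs).LFunction 1‖ ≤ 1 / Real.log q ^ 10 := by
  have hn : (NumberField.discr K).natAbs = q := natAbs_discr_eq hd
  -- transport the instance-dependent statement along `|d_K| = q`
  have key : ∀ (m : ℕ) [NeZero m] (χ : DirichletCharacter ℂ m), m = q → IsSiegelZero χ η →
      ‖χ.LFunction 1‖ ≤ 1 / Real.log q ^ 10 := by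
    intro m _ χ hm hSm
    subst hm
    have h := RealZeroRepulsion.isSiegelZero_eta_le_log_sq_div hq hSm h40
    have hq1 : (1 : ℝ) < m := by exact_mod_cast (show 1 < m by omega)
    have hlog : 0 < Real.log m := Real.log_pos hq1
    have hlog1 : 1 < Real.log m := by
      have h9 := Real.exp_one_lt_d9
      rw [Real.lt_log_iff_exp_lt (by linarith)]
      have : (232 : ℝ) ≤ m := by exact_mod_cast hq
      linarith
    have hηpos : 0 < η := by linarith
    -- `‖L‖ ≤ log m / η ≤ log m / (log m)^11 = 1/(log m)^10`
    have h1 : ‖χ.LFunction 1‖ ≤ Real.log m / η := by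
      rw [le_div_iff₀ hηpos]
      have h' : ‖χ.LFunction 1‖ * Real.log m * η ≤ Real.log m ^ 2 := by
        have := mul_le_mul_of_nonneg_right h hηpos.le
        rwa [div_mul_cancel₀ _ hηpos.ne'] at this
      nlinarith [norm_nonneg (χ.LFunction 1)]
    have h2 : Real.log m / η ≤ Real.log m / Real.log m ^ 11 :=
      div_le_div_of_nonneg_left hlog.le (by positivity) hη
    have h3 : Real.log m / Real.log m ^ 11 = 1 / Real.log m ^ 10 := by
      field_simp
    linarith [h3 ▸ h2]
  exact key _ _ hn hS

/-- **Theorem 5 read on the column's zero-side predicate** (PROVED modulo the named fact): for every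
`ε > 0` there are `c > 0` and `q₀` such that for every quadratic `K` with `d_K = −q`, `q ≥ q₀` prime,
`q ≡ 3 (mod 4)`, whose character `jacobiChar q` has a Siegel zero of quality
`η ≥ max(40, (log q)^{11})`: `N_q(P) ≥ c·h_K·P/(√q log²q)` for all `q^{1/2+ε} ≤ P ≤ q`.
[cite: DunnKerrShparlinskiZaharescu2020, §1.2 Theorem 5] [cite: TaoTeravainen2021, Definition 1.4] -/
theorem splitPrimeCount_ge_of_isSiegelZero (h5 : dksz2020_theorem5) {ε : ℝ} (hε : 0 < ε) :
    ∃ c : ℝ, 0 < c ∧ ∃ q₀ : ℕ, ∀ (K : Type) [Field K] [NumberField K], finrank ℚ K = 2 →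
      ∀ q : ℕ, q.Prime → q % 4 = 3 → q₀ ≤ q → NumberField.discr K = -(q : ℤ) →
        ∀ η : ℝ, IsSiegelZero (jacobiChar (NumberField.discr K).natAbs) η → 40 ≤ η →
          Real.log q ^ 11 ≤ η →
          ∀ P : ℝ, (q : ℝ) ^ (1 / 2 + ε) ≤ P → P ≤ q →
            c * (classNumber K : ℝ) * P / (Real.sqrt q * Real.log q ^ 2) ≤ (splitPrimeCount K P : ℝ) := by
  obtain ⟨c, hc, q₀, H⟩ := h5 ε hε 1
  refine ⟨c, hc, max q₀ 232, fun K _ _ h2 q hq hq4 hq₀ hd η hS h40 hη P hP1 hP2 => ?_⟩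
  have hq₀' : q₀ ≤ q := le_trans (le_max_left _ _) hq₀
  have h232 : 232 ≤ q := le_trans (le_max_right _ _) hq₀
  exact H K h2 q hq hq4 hq₀' hd (lOne_hypothesis_of_isSiegelZero hd h232 hS h40 hη) P hP1 hP2

/-- **Theorem 5 in `L(1)`-currency** (PROVED modulo the named fact, through the tree's class number
formula `L(1, χ_{d_K}) = 2π h_K/(w_K √|d_K|)` and `w_K = 2` for `d_K < −4`): under the hypotheses of
Theorem 5 (and `q ≥ 5`), `N_q(P) ≥ (c/π)·L(1,χ)·P/(log q)²`. This is the shape the proof actually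
delivers (§5.3, last display: "using (5.11) and Dirichlet's class number formula").
[cite: DunnKerrShparlinskiZaharescu2020, §1.2 Theorem 5 and §5.3]
[cite: NeukirchANT1999, Ch. VII §5 (5.11)] -/
theorem splitPrimeCount_ge_lOne (h5 : dksz2020_theorem5) {ε : ℝ} (hε : 0 < ε) (C : ℝ) :
    ∃ c : ℝ, 0 < c ∧ ∃ q₀ : ℕ, ∀ (K : Type) [Field K] [NumberField K], finrank ℚ K = 2 →
      ∀ q : ℕ, q.Prime → q % 4 = 3 → q₀ ≤ q → NumberField.discr K = -(q : ℤ) →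
        ‖(jacobiChar (NumberField.discr K).natAbs).LFunction 1‖ ≤ C / Real.log q ^ 10 →
          ∀ P : ℝ, (q : ℝ) ^ (1 / 2 + ε) ≤ P → P ≤ q →
            c * ‖(jacobiChar (NumberField.discr K).natAbs).LFunction 1‖ * P / Real.log q ^ 2 ≤
              (splitPrimeCount K P : ℝ) := by
  obtain ⟨c, hc, q₀, H⟩ := h5 ε hε C
  refine ⟨c / Real.pi, div_pos hc Real.pi_pos, max q₀ 5,
    fun K _ _ h2 q hq hq4 hq₀ hd hL P hP1 hP2 => ?_⟩
  have hq₀' : q₀ ≤ q := le_trans (le_max_left _ _) hq₀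
  have hq5 : 5 ≤ q := le_trans (le_max_right _ _) hq₀
  have hmain := H K h2 q hq hq4 hq₀' hd hL P hP1 hP2
  -- class number formula: `L(1,χ) = 2π h/(w √q)` with `w = 2`
  have hdneg : NumberField.discr K < -4 := by rw [hd]; omega
  have hdneg' : NumberField.discr K < 0 := by omega
  have hodd : Odd (NumberField.discr K) := by
    rw [hd, Int.odd_iff]
    have hq2 : (q : ℤ) % 4 = 3 := by exact_mod_cast hq4
    omega
  have hw : torsionOrder K = 2 := torsionOrder_eq_two_of_discr_lt_neg_four h2 hdneg
  have hcnf := LFunction_jacobiChar_one_eq_of_discr_neg h2 hodd hdneg'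
  have habs : |(NumberField.discr K : ℝ)| = q := by
    rw [hd]; push_cast; rw [abs_neg, abs_of_nonneg (by positivity)]
  rw [hw, habs] at hcnf
  have hq0 : (0 : ℝ) < q := by exact_mod_cast (show 0 < q by omega)
  have hsq : 0 < Real.sqrt q := Real.sqrt_pos.mpr hq0
  have hh0 : (0 : ℝ) ≤ classNumber K := by positivity
  have hnorm : ‖(jacobiChar (NumberField.discr K).natAbs).LFunction 1‖ =
      Real.pi * classNumber K / Real.sqrt q := by
    rw [hcnf, Complex.norm_real, Real.norm_eq_abs, abs_of_nonneg]
    · push_cast; field_simp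
    · push_cast; positivity
  -- `(c/π)·(π h/√q)·P/log²q = c h P/(√q log² q)`
  have hlog : 0 < Real.log q := Real.log_pos (by exact_mod_cast (show 1 < q by omega))
  have heq : c / Real.pi * ‖(jacobiChar (NumberField.discr K).natAbs).LFunction 1‖ * P /
      Real.log q ^ 2 = c * (classNumber K : ℝ) * P / (Real.sqrt q * Real.log q ^ 2) := by
    rw [hnorm]
    field_simp
  rw [heq]
  exact hmain


/-! ### Appended 2026-08-27: where the hypothesis (1.5) is VOID (kernel; PROVED only, debt 0) -/

/-- For a prime `q ≡ 3 (mod 4)` and `d_K = −q`: the character `jacobiChar |d_K| = jacobiChar q` is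
primitive and quadratic, and `|d_K| = q ≥ 3`. [folklore] -/
private theorem jacobiChar_basic {q : ℕ} (hq : q.Prime) (hq4 : q % 4 = 3)
    (hd : NumberField.discr K = -(q : ℤ)) :
    (jacobiChar (NumberField.discr K).natAbs).IsPrimitive ∧
      (jacobiChar (NumberField.discr K).natAbs).IsQuadratic ∧ (NumberField.discr K).natAbs = q := by
  have hn : (NumberField.discr K).natAbs = q := natAbs_discr_eq hd
  refine ⟨?_, isQuadratic_jacobiChar, hn⟩
  have hodd : Odd q := hq.odd_of_ne_two (by omega)
  have hsq : Squarefree q := hq.squarefree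
  -- transport along `|d_K| = q`
  have key : ∀ (m : ℕ) [NeZero m], m = q → (jacobiChar m).IsPrimitive := by
    intro m _ hm; subst hm; exact isPrimitive_jacobiChar hodd hsq
  exact key _ hn

/-- **Kernel vacuity of (1.5) at small conductors.** The class-number-formula floor
`‖L(1,χ)‖ ≥ 0.69/√q` (tree: `RealZeroRepulsion.norm_LFunction_one_ge`, every primitive quadratic
`χ`, `q ≥ 3`) makes the hypothesis `L(1,χ_{−q}) ≤ C/(log q)^{10}` of Theorem 5 IMPOSSIBLE whenever
`C√q < 0.69 (log q)^{10}` — e.g. for `C = 1` at every `q ≤ e^{89} ≈ 10^{38}` (the function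
`(log q)^{10}/√q` exceeds `1/0.69` throughout `[3, e^{89}]`): the «illusory» split-prime regime of I.18
lives far above any certified table. [cite: DunnKerrShparlinskiZaharescu2020, §1.2 Theorem 5 (hypothesis (1.5))] -/
theorem not_lOne_hypothesis_of_small {q : ℕ} (hq : q.Prime) (hq4 : q % 4 = 3)
    (hd : NumberField.discr K = -(q : ℤ)) {C : ℝ}
    (hsmall : C * Real.sqrt q < 69 / 100 * Real.log q ^ 10) :
    ¬ ‖(jacobiChar (NumberField.discr K).natAbs).LFunction 1‖ ≤ C / Real.log q ^ 10 := by
  obtain ⟨hprim, hquad, hn⟩ := jacobiChar_basic (K := K) hq hq4 hd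
  have hq3 : 3 ≤ q := by have := hq.two_le; omega
  have key : ∀ (m : ℕ) [NeZero m] (χ : DirichletCharacter ℂ m), m = q → χ.IsPrimitive →
      χ.IsQuadratic → ¬ ‖χ.LFunction 1‖ ≤ C / Real.log q ^ 10 := by
    intro m _ χ hm hp hqd hle
    subst hm
    have hfloor := RealZeroRepulsion.norm_LFunction_one_ge hq3 hp hqd
    have hq3r : (3 : ℝ) ≤ m := by exact_mod_cast hq3
    have hsq : 0 < Real.sqrt m := Real.sqrt_pos.mpr (by linarith)
    have hlog : 0 < Real.log m := Real.log_pos (by linarith)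
    have hpow : 0 < Real.log m ^ 10 := pow_pos hlog 10
    -- `0.69/√q ≤ C/(log q)^10` contradicts `C √q < 0.69 (log q)^10`
    have h1 : 69 / 100 / Real.sqrt m ≤ C / Real.log m ^ 10 := hfloor.trans hle
    rw [div_le_div_iff₀ hsq hpow] at h1
    linarith
  exact key _ _ hn hprim hquad

/-- **Kernel vacuity of (1.5) on the certified range.** Under the wide criterion `NoRealZeroUpTo Q`
the kernel's explicit Hecke lemma (`Hecke.lOne_ge_eighth_of_noRealZeroUpTo`: `L(1,χ) ≥ 1/(8 log q)`
for primitive quadratic `χ`, `10⁴ ≤ q ≤ Q`) makes `L(1,χ_{−q}) ≤ C/(log q)^{10}` impossible for every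
prime `q ≡ 3 (4)` with `10⁴ ≤ q ≤ Q` and `8C < (log q)^9` (for `C ≤ 10⁸`: all such `q`, as
`(log 10⁴)^9 > 10⁸·8`) — so on the booked decade `Q = 10¹⁰` (and `3·10¹⁰` once route G books) the
hypothesis of Theorem 5 has NO instance. [cite: DunnKerrShparlinskiZaharescu2020, §1.2 Theorem 5 (hypothesis (1.5))]
[cite: Platt2016GRH, Theorems 7.1 and 7.2] -/
theorem not_lOne_hypothesis_of_noRealZeroUpTo {Q : ℕ} (hW : NoRealZeroUpTo Q) {q : ℕ} (hq : q.Prime)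
    (hq4 : q % 4 = 3) (hq1 : 10 ^ 4 ≤ q) (hqQ : q ≤ Q) (hd : NumberField.discr K = -(q : ℤ)) {C : ℝ}
    (hC : 8 * C < Real.log q ^ 9) :
    ¬ ‖(jacobiChar (NumberField.discr K).natAbs).LFunction 1‖ ≤ C / Real.log q ^ 10 := by
  obtain ⟨hprim, hquad, hn⟩ := jacobiChar_basic (K := K) hq hq4 hd
  have key : ∀ (m : ℕ) [NeZero m] (χ : DirichletCharacter ℂ m), m = q → χ.IsPrimitive →
      χ.IsQuadratic → ¬ ‖χ.LFunction 1‖ ≤ C / Real.log q ^ 10 := by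
    intro m _ χ hm hp hqd hle
    subst hm
    have hH := Hecke.lOne_ge_eighth_of_noRealZeroUpTo χ hW hq1 hqQ hp hqd
    have hq' : (10 ^ 4 : ℝ) ≤ m := by exact_mod_cast hq1
    have hlog : 0 < Real.log m := Real.log_pos (by linarith)
    have hpow : 0 < Real.log m ^ 10 := pow_pos hlog 10
    -- `Re L(1) ≤ ‖L(1)‖ ≤ C/(log q)^10` and `1/(8 log q) ≤ Re L(1)`
    have hre : (χ.LFunction 1).re ≤ ‖χ.LFunction 1‖ := Complex.re_le_norm _
    have h1 : 1 / (8 * Real.log m) ≤ C / Real.log m ^ 10 := hH.trans (hre.trans hle)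
    rw [div_le_div_iff₀ (by positivity) hpow] at h1
    -- h1 : 1 * (log m)^10 ≤ C * (8 log m)
    have : Real.log m ^ 10 = Real.log m ^ 9 * Real.log m := by ring
    nlinarith
  exact key _ _ hn hprim hquad

/-- Decade instance (`Q = 10¹⁰`, booked two-lineage): no prime `q ≡ 3 (4)` with `10⁴ ≤ q ≤ 10¹⁰`
satisfies (1.5) with any `C < (log q)^9/8`. [cite: DunnKerrShparlinskiZaharescu2020, §1.2 Theorem 5 (hypothesis (1.5))] -/
theorem not_lOne_hypothesis_upTo_1e10_of_leaf (hW : NoRealZeroUpTo_1e10) {q : ℕ} (hq : q.Prime)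
    (hq4 : q % 4 = 3) (hq1 : 10 ^ 4 ≤ q) (hqQ : q ≤ 10 ^ 10) (hd : NumberField.discr K = -(q : ℤ))
    {C : ℝ} (hC : 8 * C < Real.log q ^ 9) :
    ¬ ‖(jacobiChar (NumberField.discr K).natAbs).LFunction 1‖ ≤ C / Real.log q ^ 10 :=
  not_lOne_hypothesis_of_noRealZeroUpTo hW hq hq4 hq1 (by norm_num at hqQ ⊢; exact hqQ) hd hC

end DKSZ2020

end Literature.NumberTheory.LFunctions

end
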